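import Summits.Ventures.PackingBounds.ThreePointCert.SoundExactPSD

/-!
# Soundness of the exact three-point certificate checker, II: the lift `M = V S Vᵀ`

Framing: lottery ticket; floor = certified bounds/negative ranges. Venture `PackingBounds`
(cell `pub-packcert`), three-point SDP family.

Entries of the lifted block `M = V S Vᵀ` computed by `Wrow`/`Mrow` (`V = [diag(lv); C]`) and the
bilinear identities `Σ M_{jl} Ψ(j,l) = Σ S(c,e) Σ V(j,c)V(l,e)Ψ(j,l)` (`sumM_eq`, `quadM_eq`).
-/

noncomputable section

open Finset
open scoped RealInnerProductSpace

namespace Summit.Ventures.PackingBounds.ThreePointCert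

open Literature.Geometry.DiscreteGeometry Literature.Geometry.DiscreteGeometry.PolyCert
open Literature.Geometry.DiscreteGeometry.PolyCert.SPoly
open Literature.Analysis.SpecialFunctions

/-! ### The lift `M = V S Vᵀ` -/

/-- Entry `(j, a)` of the lift matrix `V = [diag(lv); C]` (`m × f`). -/
def Lift.ent (V : Lift) (f j a : ℕ) : ℤ :=
  if j < f then (if a = j then V.lv.getD j 0 else 0) else (V.C.getD (j - f) []).getD a 0

/-- `getD` of a `zipWith` of two lists at an index inside both. -/
theorem getD_zipWith_of_lt {α β γ : Type*} (g : α → β → γ) (a : List α) (b : List β) (da : α) (db : β)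
    (dc : γ) (i : ℕ) (ha : i < a.length) (hb : i < b.length) :
    (List.zipWith g a b).getD i dc = g (a.getD i da) (b.getD i db) := by
  rw [List.getD_eq_getElem?_getD, List.getElem?_zipWith, List.getD_eq_getElem?_getD,
    List.getD_eq_getElem?_getD, List.getElem?_eq_getElem ha, List.getElem?_eq_getElem hb]
  rfl

/-- `combRows`: length `f` and entries `Σ_a c_a S_a[b]`. -/
theorem combRows_spec (f : ℕ) :
    ∀ (c : List ℤ) (S : List (List ℤ)), (∀ r ∈ S, r.length = f) → c.length ≤ S.length →
      (combRows f c S).length = f ∧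
        ∀ b, b < f → (combRows f c S).getD b 0 =
          ∑ a ∈ range c.length, c.getD a 0 * (S.getD a []).getD b 0
  | [], S, _, _ => by
    refine ⟨by simp [combRows], fun b hb => ?_⟩
    simp [combRows, List.getD_eq_getElem?_getD, hb]
  | ci :: c, [], _, h => by simp at h
  | ci :: c, row :: S, hS, hlen => by
    have hrow : row.length = f := hS row (by simp)
    have ih := combRows_spec f c S (fun r hr => hS r (by simp [hr])) (by simpa using hlen)
    refine ⟨?_, fun b hb => ?_⟩
    · simp [combRows, List.length_zipWith, ih.1, hrow]
    · rw [combRows, getD_zipWith_of_lt _ _ _ 0 0 0 b (by simp [hrow, hb]) (by rw [ih.1]; exact hb),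
        ih.2 b hb, List.length_cons, Finset.sum_range_succ']
      simp only [List.getD_cons_succ, List.getD_cons_zero]
      have hm : (List.map (fun x => ci * x) row).getD b 0 = ci * row.getD b 0 := by
        rw [List.getD_eq_getElem?_getD, List.getElem?_map, List.getElem?_eq_getElem (by rw [hrow]; exact hb),
          List.getD_eq_getElem?_getD, List.getElem?_eq_getElem (by rw [hrow]; exact hb)]
        rfl
      rw [hm, add_comm]


/-- `dotZ a b acc = acc + Σ_{i<|a|} a_i b_i` when `|a| ≤ |b|`. -/
theorem dotZ_eq_sum : ∀ (a b : List ℤ) (acc : ℤ), a.length ≤ b.length →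
    dotZ a b acc = acc + ∑ i ∈ range a.length, a.getD i 0 * b.getD i 0
  | [], _, acc, _ => by simp [dotZ]
  | x :: a, [], acc, h => by simp at h
  | x :: a, y :: b, acc, h => by
    rw [dotZ, dotZ_eq_sum a b _ (by simpa using h), List.length_cons, Finset.sum_range_succ']
    simp only [List.getD_cons_succ, List.getD_cons_zero]
    ring

/-- Rows of `Srows p`: `f` rows of length `f` with entries `Sent p a b`. -/
theorem Srows_spec (p : PSDBlk) :
    (Srows p).length = p.f ∧ (∀ r ∈ Srows p, r.length = p.f) ∧
      ∀ a b, a < p.f → b < p.f → ((Srows p).getD a []).getD b 0 = Sent p a b := by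
  refine ⟨by simp [Srows], fun r hr => ?_, fun a b ha hb => ?_⟩
  · simp only [Srows, List.mem_map, List.mem_range] at hr
    obtain ⟨i, _, rfl⟩ := hr; simp
  · simp only [Srows, List.getD_eq_getElem?_getD, List.getElem?_map, List.getElem?_range ha, Option.map_some,
      Option.getD_some, List.getElem?_range hb]

/-- `Wrow`: length `f` and entries `Σ_a V(j,a) S_a[b]`. -/
theorem Wrow_spec (V : Lift) (S : List (List ℤ)) (f j : ℕ) (hlv : V.lv.length = f)
    (hC : ∀ r ∈ V.C, r.length = f) (hS : S.length = f) (hSr : ∀ r ∈ S, r.length = f) (hj : j < V.m) :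
    (Wrow V S f j).length = f ∧
      ∀ b, b < f → (Wrow V S f j).getD b 0 = ∑ a ∈ range f, V.ent f j a * (S.getD a []).getD b 0 := by
  unfold Wrow Lift.ent
  by_cases hjf : j < f
  · simp only [if_pos hjf]
    have hrow : (S.getD j []).length = f := by
      rw [List.getD_eq_getElem?_getD, List.getElem?_eq_getElem (by rw [hS]; exact hjf)]
      exact hSr _ (List.getElem_mem _)
    refine ⟨by rw [List.length_map]; exact hrow, fun b hb => ?_⟩
    rw [List.getD_eq_getElem?_getD, List.getElem?_map, List.getElem?_eq_getElem (by rw [hrow]; exact hb)]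
    simp only [Option.map_some, Option.getD_some]
    have e : ∀ a ∈ range f, (if a = j then V.lv.getD j 0 else 0) * (S.getD a []).getD b 0 =
        if a = j then V.lv.getD j 0 * (S.getD a []).getD b 0 else 0 := fun a _ => by split_ifs <;> simp
    rw [Finset.sum_congr rfl e, Finset.sum_ite_eq' (range f) j, if_pos (mem_range.2 hjf),
      List.getD_eq_getElem?_getD (l := S.getD j []), List.getElem?_eq_getElem (by rw [hrow]; exact hb)]
    simp
  · simp only [if_neg hjf]
    have hjC : j - f < V.C.length := by unfold Lift.m at hj; omega
    have hc : (V.C.getD (j - f) []).length = f := by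
      rw [List.getD_eq_getElem?_getD, List.getElem?_eq_getElem hjC]; exact hC _ (List.getElem_mem _)
    have h := combRows_spec f (V.C.getD (j - f) []) S hSr (by rw [hc, hS])
    refine ⟨h.1, fun b hb => ?_⟩
    rw [h.2 b hb, hc]

/-- `getD` on an appended list, left part. -/
theorem getD_append_left' {α : Type*} (l l' : List α) (d : α) (i : ℕ) (h : i < l.length) :
    (l ++ l').getD i d = l.getD i d := by
  rw [List.getD_eq_getElem?_getD, List.getElem?_append_left h, List.getD_eq_getElem?_getD]

/-- `getD` on an appended list, right part. -/
theorem getD_append_right' {α : Type*} (l l' : List α) (d : α) (i : ℕ) (h : l.length ≤ i) :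
    (l ++ l').getD i d = l'.getD (i - l.length) d := by
  rw [List.getD_eq_getElem?_getD, List.getElem?_append_right h, List.getD_eq_getElem?_getD]

/-- `Mrow`: length `m` and entries `Σ_b W_j[b] V(l,b)`. -/
theorem Mrow_spec (V : Lift) (S : List (List ℤ)) (f j : ℕ) (hlv : V.lv.length = f)
    (hC : ∀ r ∈ V.C, r.length = f) (hS : S.length = f) (hSr : ∀ r ∈ S, r.length = f) (hj : j < V.m) :
    (Mrow V S f j).length = V.m ∧
      ∀ l, l < V.m → (Mrow V S f j).getD l 0 =
        ∑ b ∈ range f, (Wrow V S f j).getD b 0 * V.ent f l b := by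
  have hW := Wrow_spec V S f j hlv hC hS hSr hj
  have hlen1 : (List.zipWith (· * ·) (Wrow V S f j) V.lv).length = f := by simp [hW.1, hlv]
  refine ⟨by unfold Mrow Lift.m; simp [hW.1, hlv], fun l hl => ?_⟩
  unfold Mrow Lift.ent
  by_cases hlf : l < f
  · rw [getD_append_left' _ _ _ _ (by rw [hlen1]; exact hlf), getD_zipWith_of_lt _ _ _ 0 0 0 l (by rw [hW.1]; exact hlf)
      (by rw [hlv]; exact hlf)]
    simp only [if_pos hlf]
    have e : ∀ b ∈ range f, (Wrow V S f j).getD b 0 * (if b = l then V.lv.getD l 0 else 0) =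
        if b = l then (Wrow V S f j).getD b 0 * V.lv.getD l 0 else 0 := fun b _ => by split_ifs <;> simp
    rw [Finset.sum_congr rfl e, Finset.sum_ite_eq' (range f) l, if_pos (mem_range.2 hlf)]
  · rw [getD_append_right' _ _ _ _ (by rw [hlen1]; omega), hlen1]
    simp only [if_neg hlf]
    have hlC : l - f < V.C.length := by unfold Lift.m at hl; omega
    have hcd : V.C.getD (l - f) [] = V.C[l - f] := by
      rw [List.getD_eq_getElem?_getD, List.getElem?_eq_getElem hlC, Option.getD_some]
    have hc' : (V.C[l - f]).length = f := hC _ (List.getElem_mem _)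
    rw [List.getD_eq_getElem?_getD, List.getElem?_map, List.getElem?_eq_getElem hlC]
    simp only [Option.map_some, Option.getD_some]
    rw [dotZ_eq_sum _ _ 0 (by rw [hc', hW.1]), hc', zero_add]
    refine Finset.sum_congr rfl fun b _ => ?_
    rw [mul_comm, hcd]


/-- Shape hypotheses of a lifted face block. -/
structure LiftOK (V : Lift) (p : PSDBlk) : Prop where
  /-- `|lv| = f` -/
  hlv : V.lv.length = p.f
  /-- the dependent rows have length `f` -/
  hC : ∀ r ∈ V.C, r.length = p.f
  /-- the face block passes `psdOK` -/
  hp : psdOK p = true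

/-- **Entries of `M = V S Vᵀ`**: for `j, l < m`,
`M_{jl} = Σ_{a,b<f} V(j,a) S(a,b) V(l,b)`. -/
theorem Mrow_entry (V : Lift) (p : PSDBlk) (h : LiftOK V p) (j l : ℕ) (hj : j < V.m) (hl : l < V.m) :
    (Mrow V (Srows p) p.f j).getD l 0 =
      ∑ a ∈ range p.f, ∑ b ∈ range p.f, V.ent p.f j a * Sent p a b * V.ent p.f l b := by
  obtain ⟨hS, hSr, hSe⟩ := Srows_spec p
  have hW := Wrow_spec V (Srows p) p.f j h.hlv h.hC hS hSr hj
  rw [(Mrow_spec V (Srows p) p.f j h.hlv h.hC hS hSr hj).2 l hl, Finset.sum_comm]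
  refine Finset.sum_congr rfl fun b hb => ?_
  rw [hW.2 b (mem_range.1 hb), Finset.sum_mul]
  refine Finset.sum_congr rfl fun a ha => ?_
  rw [hSe a b (mem_range.1 ha) (mem_range.1 hb)]

/-- Length of `Mrow`. -/
theorem Mrow_length (V : Lift) (p : PSDBlk) (h : LiftOK V p) (j : ℕ) (hj : j < V.m) :
    (Mrow V (Srows p) p.f j).length = V.m := by
  obtain ⟨hS, hSr, -⟩ := Srows_spec p
  exact (Mrow_spec V (Srows p) p.f j h.hlv h.hC hS hSr hj).1

/-- **The quadratic form of `M` is the quadratic form of `S` on the lifted vectors**: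
`Σ_{j,l<m} M_{jl} β_j γ_l = Σ_{a,b<f} S(a,b) (Σ_j V(j,a) β_j) (Σ_l V(l,b) γ_l)`. -/
theorem quadM_eq (V : Lift) (p : PSDBlk) (h : LiftOK V p) (β γ : ℕ → ℝ) :
    ∑ j ∈ range V.m, ∑ l ∈ range V.m, ((Mrow V (Srows p) p.f j).getD l 0 : ℝ) * (β j * γ l) =
      ∑ a ∈ range p.f, ∑ b ∈ range p.f, (Sent p a b : ℝ) *
        ((∑ j ∈ range V.m, (V.ent p.f j a : ℝ) * β j) * (∑ l ∈ range V.m, (V.ent p.f l b : ℝ) * γ l)) := by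
  have e : ∀ j ∈ range V.m, ∀ l ∈ range V.m, ((Mrow V (Srows p) p.f j).getD l 0 : ℝ) * (β j * γ l) =
      ∑ a ∈ range p.f, ∑ b ∈ range p.f, (Sent p a b : ℝ) * (((V.ent p.f j a : ℝ) * β j) * ((V.ent p.f l b : ℝ) * γ l)) := by
    intro j hj l hl
    rw [Mrow_entry V p h j l (mem_range.1 hj) (mem_range.1 hl)]
    push_cast
    rw [Finset.sum_mul]
    refine Finset.sum_congr rfl fun a _ => ?_
    rw [Finset.sum_mul]
    refine Finset.sum_congr rfl fun b _ => ?_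
    ring
  rw [Finset.sum_congr rfl fun j hj => Finset.sum_congr rfl fun l hl => e j hj l hl]
  -- move `a`, `b` outward: (j, l, a, b) -> (a, b, j, l)
  have s1 : ∀ j ∈ range V.m, ∑ l ∈ range V.m, ∑ a ∈ range p.f, ∑ b ∈ range p.f,
      (Sent p a b : ℝ) * (((V.ent p.f j a : ℝ) * β j) * ((V.ent p.f l b : ℝ) * γ l)) =
      ∑ a ∈ range p.f, ∑ b ∈ range p.f, ∑ l ∈ range V.m,
      (Sent p a b : ℝ) * (((V.ent p.f j a : ℝ) * β j) * ((V.ent p.f l b : ℝ) * γ l)) := by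
    intro j _
    rw [Finset.sum_comm]
    exact Finset.sum_congr rfl fun a _ => Finset.sum_comm
  rw [Finset.sum_congr rfl s1, Finset.sum_comm]
  refine Finset.sum_congr rfl fun a _ => ?_
  rw [Finset.sum_comm]
  refine Finset.sum_congr rfl fun b _ => ?_
  rw [Finset.sum_mul_sum, Finset.mul_sum]
  refine Finset.sum_congr rfl fun j _ => ?_
  rw [Finset.mul_sum]

end Summit.Ventures.PackingBounds.ThreePointCert

end
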